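import Mathlib.MeasureTheory.Integral.IntegralEqImproper
import Literature.Geometry.Lorentzian.KerrSeparatedCurrents
import HarnessLib

/-!
# The current `ϟ^y − E·Q^T` of the time-dominated regime: boundary values, the integrated
# identity and the coercivity inequality (Dafermos–Rodnianski–Shlapentokh-Rothman, §8.2, §8.4)

(family `gr`, infrastructure for statement **gr.S24**; namespace `Literature.Geometry.Lorentzian.Kerr`)

Dafermos–Rodnianski–Shlapentokh-Rothman (*Decay for solutions of the wave equation on Kerr
exterior spacetimes III*, arXiv:1402.7034 = Ann. of Math. 183 (2016)) prove the
frequency-localised multiplier estimates of their Theorem 8.1 range by range. In the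
time-dominated, non-superradiant range `𝓖_♯` (§8.4, Proposition 8.4.1) the current is
`Q = ϟ^y − E·Q^T` with `E ≥ 2`: for a smooth solution `u(r*)` of the radial ODE
`u'' + (ω² − V)u = H` (§5.2.3) obeying the boundary conditions
`u' − iωu → 0` at `r* = +∞` and `u' + i(ω − ω₊m)u → 0` at `r* = −∞` (§5.3, (eq:b+), (eq:b−)),
integrating `Q' = y'(|u'|² + (ω² − V)|u|²) − yV'|u|² + 2y Re(u'H̄) − Eω Im(Hū)` (§7.1–§7.2) over
`r* ∈ ℝ` gives the identity displayed in the proof of Proposition 8.4.1,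
`∫ [y'(|u'|² + (ω² − V)|u|²) − yV'|u|²] + Q(−∞) − Q(+∞) = ∫ (−2y Re(u'H̄) + Eω Im(Hū))`,
with the boundary values `Q(+∞) = (2 − E) ω² |u(∞)|²` (from `y(∞) = 1`, `V(∞) = 0`) and
`Q(−∞) = ((ω − ω₊m)² + Eω(ω − ω₊m)) |u(−∞)|²` (from `y(−∞) = ½`, `ω² − V(r₊) = (ω − ω₊m)²`);
both have the good sign when `E ≥ 2` and `ω(ω − ω₊m) ≥ 0` ("the boundary terms are
non-negative due to the boundary conditions, the non-superradiance condition and the requirement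
`E ≥ 2`", loc. cit.), whence the inequality
`∫ [y'(|u'|² + (ω² − V)|u|²) − yV'|u|²] ≤ ∫ (−2y Re(u'H̄) + Eω Im(Hū))`, and, once the bulk is
shown non-negative and `≥ b(|u'|² + (ω² + Λ)|u|²)` on `[R₋*, R₊*]`, the estimate of
Proposition 8.4.1, `b ∫_{R₋*}^{R₊*} (|u'|² + (ω² + Λ)|u|²) ≤ ∫ (−2y Re(u'H̄) + Eω Im(Hū))`.

This file **proves** this chain for arbitrary real `V, y` and complex `u, H` on `ℝ` (the
variable is `x = r*`), i.e. the part of Proposition 8.4.1 that is pure ODE analysis; the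
Kerr-specific inputs of loc. cit. (the choice of `y`, and the bounds (8.4.someBoundS),
(8.4.decrease) on the potential `V = V₀ + V₁` of `KerrSeparatedPotential.lean` giving the sign of
the bulk for `(ω, m, Λ) ∈ 𝓖_♯`) are not used here and enter only through the hypotheses
`hP0`/`hcoer` of the final statements.

* `tendsto_norm_sq_of_sub_mul_tendsto_zero`, `tendsto_im_mul_conj_of_sub_mul_tendsto_zero`:
  if `u' − c u → 0` and `|u|² → A` along a filter then `|u'|² → |c|²A` and `Im(u'ū) → (Im c)A`
  (the content of "the boundary conditions (eq:b−), (eq:b+)" as used in every range of §8).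
* `tendsto_koppaCurrent`, `tendsto_energyCurrentT`, `tendsto_energyCurrentK` and their
  specialisations `…_atTop` (`c = iω`, `V → 0`, `y → 1`: `ϟ^y → 2ω²A`, `Q^T → ω²A`) and `…_atBot`
  (`c = −iϖ`, `V → ω² − ϖ²`, `y → ½`: `ϟ^y → ϖ²A`, `Q^T → −ωϖA`), `ϖ = ω − ω₊m`
  (§8.2 (microEnergyEst): `Q^T(∞) − Q^T(−∞) = ω²|u(∞)|² + ω(ω − ω₊m)|u(−∞)|²`).
* `koppaBulk` = the bulk `y'(|u'|² + (ω² − V)|u|²) − yV'|u|²`; `hasDerivAt_koppa_sub_energyT`;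
  `integral_koppaBulk_eq` (the integrated identity with boundary values `qtop − qbot`);
  `integral_koppaBulk_le` (the inequality under `E ≥ 2`, `ωϖ ≥ 0`);
  `integrable_koppaBulk_of_nonneg` (a non-negative bulk is automatically integrable, so that no
  integrability hypothesis on it is needed); `timeDominated_estimate` (the estimate of
  Proposition 8.4.1 given the sign and coercivity of the bulk).

Sign conventions. With `(Q^T)' = ω Im(Hū)` (§7.2, `hasDerivAt_energyCurrentT`) and
`Q = ϟ^y − E·Q^T`, the right-hand side is `−2y Re(u'H̄) + Eω Im(Hū)`, as in the statement of
Proposition 8.4.1; in the display inside its proof the horizon bracket and the last term are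
printed as `−(½|u'|² + (½(ω − ω₊m)² − Eω(ω − ω₊m))|u|²)_{r=r₊}` and `+Eω Im(H̄u)`, which we read
with the signs forced by §7.2 (`+(½|u'|² + (½(ω − ω₊m)² + Eω(ω − ω₊m))|u|²)_{r=r₊}`, `Im(Hū)`), the
reading under which the bracket is non-negative for non-superradiant frequencies as asserted
there.

## References

* M. Dafermos, I. Rodnianski, Y. Shlapentokh-Rothman, arXiv:1402.7034 = Ann. of Math. 183
  (2016), §5.3 (boundary conditions (eq:b±)), §7.1–§7.2 (currents), §8.2 ((microEnergyEst)),
  §8.4 (Proposition 8.4.1 and the identity in its proof)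
  (key `DafermosRodnianskiShlapentokhrothman2014`).
-/

noncomputable section

open scoped InnerProductSpace ComplexConjugate
open Filter Topology MeasureTheory Set

namespace Literature.Geometry.Lorentzian

namespace Kerr

/-! ### Plane-wave asymptotics: limits of `|u'|²` and `Im(u'ū)` -/

section PlaneWave

variable {l : Filter ℝ} {u u₁ : ℝ → ℂ} {c : ℂ} {A : ℝ}

/-- If `|u|² → A` along a filter then `|u| → √A`. [folklore] -/
theorem tendsto_norm_of_tendsto_norm_sq (hA : Tendsto (fun x ↦ ‖u x‖ ^ 2) l (𝓝 A)) :
    Tendsto (fun x ↦ ‖u x‖) l (𝓝 (Real.sqrt A)) := by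
  have h := hA.sqrt
  simp_rw [Real.sqrt_sq (norm_nonneg _)] at h
  exact h

/-- A limit of `|u|²` along a non-trivial filter is non-negative. [folklore] -/
theorem nonneg_of_tendsto_norm_sq [l.NeBot] (hA : Tendsto (fun x ↦ ‖u x‖ ^ 2) l (𝓝 A)) :
    0 ≤ A :=
  ge_of_tendsto' hA fun x ↦ by positivity

/-- `|u|` is eventually bounded if `|u|²` converges. [folklore] -/
theorem isBoundedUnder_norm_of_tendsto_norm_sq (hA : Tendsto (fun x ↦ ‖u x‖ ^ 2) l (𝓝 A)) :
    IsBoundedUnder (· ≤ ·) l (fun x ↦ ‖u x‖) :=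
  (tendsto_norm_of_tendsto_norm_sq hA).isBoundedUnder_le

/-- **Plane-wave asymptotics, modulus of the derivative**: if `u' − c u → 0` and `|u|² → A`
along a filter then `|u'|² → |c|² A`. For `c = iω` as `r* → ∞` and `c = −i(ω − ω₊m)` as
`r* → −∞` the hypothesis is the boundary condition (eq:b+), resp. (eq:b−), of DRSR
arXiv:1402.7034, §5.3. [folklore] -/
theorem tendsto_norm_sq_of_sub_mul_tendsto_zero [l.NeBot]
    (hb : Tendsto (fun x ↦ u₁ x - c * u x) l (𝓝 0))
    (hA : Tendsto (fun x ↦ ‖u x‖ ^ 2) l (𝓝 A)) :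
    Tendsto (fun x ↦ ‖u₁ x‖ ^ 2) l (𝓝 (‖c‖ ^ 2 * A)) := by
  have h0 : 0 ≤ A := nonneg_of_tendsto_norm_sq hA
  have h1 : Tendsto (fun x ↦ ‖c * u x‖) l (𝓝 (‖c‖ * Real.sqrt A)) := by
    simp_rw [norm_mul]
    exact (tendsto_norm_of_tendsto_norm_sq hA).const_mul ‖c‖
  have h2 : Tendsto (fun x ↦ ‖u₁ x‖) l (𝓝 (‖c‖ * Real.sqrt A)) := by
    refine h1.congr_dist ?_
    have hb' : Tendsto (fun x ↦ ‖u₁ x - c * u x‖) l (𝓝 0) := by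
      simpa using hb.norm
    refine squeeze_zero (fun x ↦ dist_nonneg) (fun x ↦ ?_) hb'
    rw [Real.dist_eq, abs_sub_comm]
    exact abs_norm_sub_norm_le (u₁ x) (c * u x)
  have h3 := h2.pow 2
  simp_rw [mul_pow, Real.sq_sqrt h0] at h3
  exact h3

/-- `Im(u'ū) = Im((u' − cu)ū) + (Im c)|u|²`. [folklore] -/
theorem im_mul_conj_eq_add (z w c : ℂ) :
    (z * conj w).im = ((z - c * w) * conj w).im + c.im * ‖w‖ ^ 2 := by
  have h : z * conj w = (z - c * w) * conj w + c * (w * conj w) := by ring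
  rw [h, Complex.mul_conj, Complex.normSq_eq_norm_sq, Complex.add_im]
  congr 1
  rw [Complex.mul_im, Complex.ofReal_re, Complex.ofReal_im]
  ring

/-- **Plane-wave asymptotics, the flux `Im(u'ū)`**: if `u' − c u → 0` and `|u|² → A` along a
filter then `Im(u'ū) → (Im c) A`. [folklore] -/
theorem tendsto_im_mul_conj_of_sub_mul_tendsto_zero
    (hb : Tendsto (fun x ↦ u₁ x - c * u x) l (𝓝 0))
    (hA : Tendsto (fun x ↦ ‖u x‖ ^ 2) l (𝓝 A)) :
    Tendsto (fun x ↦ (u₁ x * conj (u x)).im) l (𝓝 (c.im * A)) := by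
  have hz : Tendsto (fun x ↦ (u₁ x - c * u x) * conj (u x)) l (𝓝 0) := by
    refine hb.zero_mul_isBoundedUnder_le ?_
    have h := isBoundedUnder_norm_of_tendsto_norm_sq hA
    simpa only [Function.comp_def, Complex.norm_conj] using h
  have hz' : Tendsto (fun x ↦ ((u₁ x - c * u x) * conj (u x)).im) l (𝓝 0) := by
    simpa only [Function.comp_def, Complex.zero_im] using (Complex.continuous_im.tendsto 0).comp hz
  have key : Tendsto (fun x ↦ ((u₁ x - c * u x) * conj (u x)).im + c.im * ‖u x‖ ^ 2) l
      (𝓝 (c.im * A)) := by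
    simpa only [zero_add] using hz'.add (hA.const_mul c.im)
  exact key.congr fun x ↦ (im_mul_conj_eq_add (u₁ x) (u x) c).symm

end PlaneWave

/-! ### Boundary values of `ϟ^y`, `Q^T`, `Q^K` -/

section BoundaryValues

variable {l : Filter ℝ} {u u₁ : ℝ → ℂ} {c : ℂ} {A ω y₀ V₀ : ℝ} {V y : ℝ → ℝ}

/-- **Limit of `ϟ^y`** along a filter: if `y → y₀`, `V → V₀`, `u' − cu → 0`, `|u|² → A` then
`ϟ^y[u] → y₀(|c|²A + (ω² − V₀)A)`. DRSR arXiv:1402.7034, §8.4 (evaluation of the boundary terms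
in the proof of Prop. 8.4.1). [cite: DafermosRodnianskiShlapentokhrothman2014, §8.4] -/
theorem tendsto_koppaCurrent [l.NeBot] (hy : Tendsto y l (𝓝 y₀)) (hV : Tendsto V l (𝓝 V₀))
    (hb : Tendsto (fun x ↦ u₁ x - c * u x) l (𝓝 0))
    (hA : Tendsto (fun x ↦ ‖u x‖ ^ 2) l (𝓝 A)) :
    Tendsto (koppaCurrent ω V y u u₁) l (𝓝 (y₀ * (‖c‖ ^ 2 * A + (ω ^ 2 - V₀) * A))) := by
  show Tendsto (fun x ↦ y x * (‖u₁ x‖ ^ 2 + (ω ^ 2 - V x) * ‖u x‖ ^ 2)) l _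
  exact hy.mul ((tendsto_norm_sq_of_sub_mul_tendsto_zero hb hA).add
    ((tendsto_const_nhds.sub hV).mul hA))

/-- **Limit of `Q^T`** along a filter: if `u' − cu → 0`, `|u|² → A` then `Q^T[u] → ω (Im c) A`.
DRSR arXiv:1402.7034, §8.2 (microEnergyEst). [cite: DafermosRodnianskiShlapentokhrothman2014, §8.2] -/
theorem tendsto_energyCurrentT (hb : Tendsto (fun x ↦ u₁ x - c * u x) l (𝓝 0))
    (hA : Tendsto (fun x ↦ ‖u x‖ ^ 2) l (𝓝 A)) :
    Tendsto (energyCurrentT ω u u₁) l (𝓝 (ω * (c.im * A))) :=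
  (tendsto_im_mul_conj_of_sub_mul_tendsto_zero hb hA).const_mul ω

/-- **Limit of `Q^K`** along a filter: if `u' − cu → 0`, `|u|² → A` then
`Q^K[u] → (ω − ω₊m)(Im c) A`. DRSR arXiv:1402.7034, §8.2–§8.3.
[cite: DafermosRodnianskiShlapentokhrothman2014, §8.2] -/
theorem tendsto_energyCurrentK {M a : ℝ} {m : ℤ}
    (hb : Tendsto (fun x ↦ u₁ x - c * u x) l (𝓝 0))
    (hA : Tendsto (fun x ↦ ‖u x‖ ^ 2) l (𝓝 A)) :
    Tendsto (energyCurrentK M a ω m u u₁) l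
      (𝓝 ((ω - horizonAngularVelocity M a * m) * (c.im * A))) :=
  (tendsto_im_mul_conj_of_sub_mul_tendsto_zero hb hA).const_mul _

/-- `|iω|² = ω²`. [folklore] -/
theorem norm_I_mul_ofReal_sq (ω : ℝ) : ‖Complex.I * ω‖ ^ 2 = ω ^ 2 := by
  rw [norm_mul, Complex.norm_I, one_mul, Complex.norm_real, Real.norm_eq_abs, sq_abs]

/-- `Im(iω) = ω`. [folklore] -/
theorem I_mul_ofReal_im (ω : ℝ) : (Complex.I * ω).im = ω := by simp

/-- **`ϟ^y` at infinity** under (eq:b+): if `y → 1`, `V → 0`, `u' − iωu → 0`, `|u|² → A` as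
`r* → ∞` then `ϟ^y[u] → 2ω²A` (`= (|u'|² + ω²|u|²)(∞)`). DRSR arXiv:1402.7034, §8.4, the term
at `r = ∞` in the proof of Prop. 8.4.1. [cite: DafermosRodnianskiShlapentokhrothman2014, §8.4] -/
theorem tendsto_koppaCurrent_atTop (hy : Tendsto y atTop (𝓝 1)) (hV : Tendsto V atTop (𝓝 0))
    (hb : Tendsto (fun x ↦ u₁ x - Complex.I * ω * u x) atTop (𝓝 0))
    (hA : Tendsto (fun x ↦ ‖u x‖ ^ 2) atTop (𝓝 A)) :
    Tendsto (koppaCurrent ω V y u u₁) atTop (𝓝 (2 * ω ^ 2 * A)) := by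
  have h := tendsto_koppaCurrent (ω := ω) (c := Complex.I * ω) hy hV hb hA
  rw [norm_I_mul_ofReal_sq] at h
  convert h using 2
  ring

/-- **`Q^T` at infinity** under (eq:b+): `Q^T[u] → ω²A = ω²|u(∞)|²`. DRSR arXiv:1402.7034, §8.2
(microEnergyEst). [cite: DafermosRodnianskiShlapentokhrothman2014, §8.2] -/
theorem tendsto_energyCurrentT_atTop
    (hb : Tendsto (fun x ↦ u₁ x - Complex.I * ω * u x) atTop (𝓝 0))
    (hA : Tendsto (fun x ↦ ‖u x‖ ^ 2) atTop (𝓝 A)) :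
    Tendsto (energyCurrentT ω u u₁) atTop (𝓝 (ω ^ 2 * A)) := by
  have h := tendsto_energyCurrentT (ω := ω) (c := Complex.I * ω) hb hA
  rw [I_mul_ofReal_im] at h
  convert h using 2
  ring

/-- **`ϟ^y` at the horizon** under (eq:b−): if `y → ½`, `V → ω² − ϖ²`, `u' + iϖu → 0`,
`|u|² → A` as `r* → −∞` (`ϖ = ω − ω₊m`, `ω² − V(r₊) = ϖ²`, cf.
`Kerr.omega_sq_sub_sepPotential_rPlus`) then `ϟ^y[u] → ϖ²A` (`= ½(|u'|² + ϖ²|u|²)(−∞)`).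
DRSR arXiv:1402.7034, §8.4, the term at `r = r₊` in the proof of Prop. 8.4.1.
[cite: DafermosRodnianskiShlapentokhrothman2014, §8.4] -/
theorem tendsto_koppaCurrent_atBot {ϖ : ℝ} (hy : Tendsto y atBot (𝓝 (1 / 2)))
    (hV : Tendsto V atBot (𝓝 (ω ^ 2 - ϖ ^ 2)))
    (hb : Tendsto (fun x ↦ u₁ x + Complex.I * ϖ * u x) atBot (𝓝 0))
    (hA : Tendsto (fun x ↦ ‖u x‖ ^ 2) atBot (𝓝 A)) :
    Tendsto (koppaCurrent ω V y u u₁) atBot (𝓝 (ϖ ^ 2 * A)) := by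
  have hb' : Tendsto (fun x ↦ u₁ x - -(Complex.I * ϖ) * u x) atBot (𝓝 0) := by
    simpa [sub_neg_eq_add] using hb
  have h := tendsto_koppaCurrent (ω := ω) (c := -(Complex.I * ϖ)) hy hV hb' hA
  rw [norm_neg, norm_I_mul_ofReal_sq] at h
  convert h using 2
  ring

/-- **`Q^T` at the horizon** under (eq:b−): `Q^T[u] → −ωϖA = ω(ω − ω₊m)·(−|u(−∞)|²)`, i.e.
`−Q^T(−∞) = ω(ω − ω₊m)|u(−∞)|²`. DRSR arXiv:1402.7034, §8.2 (microEnergyEst).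
[cite: DafermosRodnianskiShlapentokhrothman2014, §8.2] -/
theorem tendsto_energyCurrentT_atBot {ϖ : ℝ}
    (hb : Tendsto (fun x ↦ u₁ x + Complex.I * ϖ * u x) atBot (𝓝 0))
    (hA : Tendsto (fun x ↦ ‖u x‖ ^ 2) atBot (𝓝 A)) :
    Tendsto (energyCurrentT ω u u₁) atBot (𝓝 (-(ω * ϖ * A))) := by
  have hb' : Tendsto (fun x ↦ u₁ x - -(Complex.I * ϖ) * u x) atBot (𝓝 0) := by
    simpa [sub_neg_eq_add] using hb
  have h := tendsto_energyCurrentT (ω := ω) (c := -(Complex.I * ϖ)) hb' hA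
  rw [Complex.neg_im, I_mul_ofReal_im] at h
  convert h using 2
  ring

/-- **`Q^K` at the horizon** under (eq:b−): `Q^K[u] → −(ω − ω₊m)ϖA`; for `ϖ = ω − ω₊m` this is
`−(ω − ω₊m)²|u(−∞)|²`. DRSR arXiv:1402.7034, §8.3 (horizon flux of `Q^K`).
[cite: DafermosRodnianskiShlapentokhrothman2014, §8.3] -/
theorem tendsto_energyCurrentK_atBot {M a ϖ : ℝ} {m : ℤ}
    (hb : Tendsto (fun x ↦ u₁ x + Complex.I * ϖ * u x) atBot (𝓝 0))
    (hA : Tendsto (fun x ↦ ‖u x‖ ^ 2) atBot (𝓝 A)) :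
    Tendsto (energyCurrentK M a ω m u u₁) atBot
      (𝓝 (-((ω - horizonAngularVelocity M a * m) * ϖ * A))) := by
  have hb' : Tendsto (fun x ↦ u₁ x - -(Complex.I * ϖ) * u x) atBot (𝓝 0) := by
    simpa [sub_neg_eq_add] using hb
  have h := tendsto_energyCurrentK (M := M) (a := a) (m := m) (ω := ω)
    (c := -(Complex.I * ϖ)) hb' hA
  rw [Complex.neg_im, I_mul_ofReal_im] at h
  convert h using 2
  ring

end BoundaryValues

/-! ### The bulk term and the current `ϟ^y − E·Q^T` -/

/-- The **bulk term of `(ϟ^y)'`**, `P^y[u] = y'(|u'|² + (ω² − V)|u|²) − yV'|u|²`, as a real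
function of `x = r*` (`V₁ = V'`, `y₁ = y'`, `u₁ = u'` as functions). DRSR arXiv:1402.7034, §7.1
(third display) and §8.4 (the integrand on the left of the identity in the proof of Prop. 8.4.1).
[cite: DafermosRodnianskiShlapentokhrothman2014, §8.4] -/
def koppaBulk (ω : ℝ) (V V₁ y y₁ : ℝ → ℝ) (u u₁ : ℝ → ℂ) (x : ℝ) : ℝ :=
  y₁ x * (‖u₁ x‖ ^ 2 + (ω ^ 2 - V x) * ‖u x‖ ^ 2) - y x * V₁ x * ‖u x‖ ^ 2

/-- Unfolding lemma for `koppaBulk`. [folklore] -/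
theorem koppaBulk_apply (ω : ℝ) (V V₁ y y₁ : ℝ → ℝ) (u u₁ : ℝ → ℂ) (x : ℝ) :
    koppaBulk ω V V₁ y y₁ u u₁ x =
      y₁ x * (‖u₁ x‖ ^ 2 + (ω ^ 2 - V x) * ‖u x‖ ^ 2) - y x * V₁ x * ‖u x‖ ^ 2 :=
  rfl

section Identity

variable {ω E : ℝ} {V V₁ y y₁ : ℝ → ℝ} {u u₁ u₂ H : ℝ → ℂ} {x : ℝ}

/-- **`(ϟ^y − E·Q^T)'`** for a solution of `u'' + (ω² − V)u = H` at `x`: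
`= P^y[u] + 2y Re(u'H̄) − Eω Im(Hū)`. DRSR arXiv:1402.7034, §7.1–§7.2 combined as in §8.4.
[cite: DafermosRodnianskiShlapentokhrothman2014, §8.4] -/
theorem hasDerivAt_koppa_sub_energyT (hV : HasDerivAt V (V₁ x) x) (hy : HasDerivAt y (y₁ x) x)
    (hu : HasDerivAt u (u₁ x) x) (hu₁ : HasDerivAt u₁ (u₂ x) x)
    (hode : u₂ x + ((ω ^ 2 - V x : ℝ) : ℂ) * u x = H x) :
    HasDerivAt (fun t ↦ koppaCurrent ω V y u u₁ t - E * energyCurrentT ω u u₁ t)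
      (koppaBulk ω V V₁ y y₁ u u₁ x + 2 * y x * ⟪H x, u₁ x⟫_ℝ -
        E * (ω * (H x * conj (u x)).im)) x := by
  have h := (hasDerivAt_koppaCurrent hV hy hu hu₁ hode).sub
    ((hasDerivAt_energyCurrentT hu hu₁ hode).const_mul E)
  refine h.congr_deriv ?_
  rw [koppaBulk_apply]

/-- The source term `2y Re(u'H̄) − Eω Im(Hū)` is integrable if its two pieces are. [folklore] -/
theorem integrable_koppa_sub_energyT_source (hS₁ : Integrable (fun x ↦ y x * ⟪H x, u₁ x⟫_ℝ))
    (hS₂ : Integrable (fun x ↦ (H x * conj (u x)).im)) :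
    Integrable (fun x ↦ 2 * y x * ⟪H x, u₁ x⟫_ℝ - E * (ω * (H x * conj (u x)).im)) := by
  have h1 : Integrable (fun x ↦ 2 * (y x * ⟪H x, u₁ x⟫_ℝ)) := hS₁.const_mul 2
  have h2 : Integrable (fun x ↦ E * (ω * (H x * conj (u x)).im)) :=
    (hS₂.const_mul ω).const_mul E
  simpa only [Pi.sub_def, mul_assoc] using h1.sub h2

variable (hV : ∀ x, HasDerivAt V (V₁ x) x) (hy : ∀ x, HasDerivAt y (y₁ x) x)
  (hu : ∀ x, HasDerivAt u (u₁ x) x) (hu₁ : ∀ x, HasDerivAt u₁ (u₂ x) x)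
  (hode : ∀ x, u₂ x + ((ω ^ 2 - V x : ℝ) : ℂ) * u x = H x)
  (hS₁ : Integrable (fun x ↦ y x * ⟪H x, u₁ x⟫_ℝ))
  (hS₂ : Integrable (fun x ↦ (H x * conj (u x)).im))
include hV hy hu hu₁ hode hS₁ hS₂

/-- **The integrated identity of §8.4** (the display in the proof of Prop. 8.4.1, abstract form):
if `u` solves `u'' + (ω² − V)u = H` on `ℝ`, the bulk `P^y[u]` and the source terms are
integrable, and `Q = ϟ^y − E·Q^T` tends to `qbot` at `−∞` and to `qtop` at `+∞`, then
`∫ P^y[u] = qtop − qbot + ∫ (−2y Re(u'H̄) + Eω Im(Hū))`. DRSR arXiv:1402.7034, §8.4.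
[cite: DafermosRodnianskiShlapentokhrothman2014, §8.4] -/
theorem integral_koppaBulk_eq {qbot qtop : ℝ} (hP : Integrable (koppaBulk ω V V₁ y y₁ u u₁))
    (hbot : Tendsto (fun x ↦ koppaCurrent ω V y u u₁ x - E * energyCurrentT ω u u₁ x)
      atBot (𝓝 qbot))
    (htop : Tendsto (fun x ↦ koppaCurrent ω V y u u₁ x - E * energyCurrentT ω u u₁ x)
      atTop (𝓝 qtop)) :
    ∫ x, koppaBulk ω V V₁ y y₁ u u₁ x =
      qtop - qbot + ∫ x, (-(2 * y x * ⟪H x, u₁ x⟫_ℝ) + E * (ω * (H x * conj (u x)).im)) := by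
  have hS := integrable_koppa_sub_energyT_source (E := E) (ω := ω) hS₁ hS₂
  have hderiv := fun x ↦
    hasDerivAt_koppa_sub_energyT (E := E) (hV x) (hy x) (hu x) (hu₁ x) (hode x)
  have hsum : Integrable (fun x ↦ koppaBulk ω V V₁ y y₁ u u₁ x + 2 * y x * ⟪H x, u₁ x⟫_ℝ -
      E * (ω * (H x * conj (u x)).im)) := by
    simpa only [Pi.add_def, add_sub_assoc] using hP.add hS
  have hftc := integral_of_hasDerivAt_of_tendsto hderiv hsum hbot htop
  have hsplit : ∫ x, (koppaBulk ω V V₁ y y₁ u u₁ x + 2 * y x * ⟪H x, u₁ x⟫_ℝ -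
      E * (ω * (H x * conj (u x)).im)) =
      (∫ x, koppaBulk ω V V₁ y y₁ u u₁ x) +
        ∫ x, (2 * y x * ⟪H x, u₁ x⟫_ℝ - E * (ω * (H x * conj (u x)).im)) := by
    rw [← integral_add hP hS]
    congr 1
    funext x
    ring
  have hneg : ∫ x, (-(2 * y x * ⟪H x, u₁ x⟫_ℝ) + E * (ω * (H x * conj (u x)).im)) =
      -∫ x, (2 * y x * ⟪H x, u₁ x⟫_ℝ - E * (ω * (H x * conj (u x)).im)) := by
    rw [← integral_neg]
    congr 1
    funext x
    ring
  rw [hneg]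
  linarith [hftc, hsplit]

/-- **The inequality of §8.4** (abstract core of Prop. 8.4.1): under the boundary conditions
(eq:b+) `u' − iωu → 0`, `|u|² → Atop`, `V → 0`, `y → 1` at `+∞` and (eq:b−) `u' + iϖu → 0`,
`|u|² → Abot`, `V → ω² − ϖ²`, `y → ½` at `−∞` (`ϖ = ω − ω₊m`), for `E ≥ 2` and non-superradiant
`ωϖ ≥ 0` the boundary values `Q(+∞) = (2 − E)ω²Atop ≤ 0 ≤ Q(−∞) = (ϖ² + Eωϖ)Abot` have the good
sign, whence `∫ P^y[u] ≤ ∫ (−2y Re(u'H̄) + Eω Im(Hū))`. DRSR arXiv:1402.7034, §8.4, proof of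
Prop. 8.4.1 ("The boundary terms are non-negative due to the boundary conditions (eq:b−) and
(eq:b+), the non-superradiance condition and the requirement `E ≥ 2`").
[cite: DafermosRodnianskiShlapentokhrothman2014, Prop. 8.4.1] -/
theorem integral_koppaBulk_le {ϖ Atop Abot : ℝ} (hP : Integrable (koppaBulk ω V V₁ y y₁ u u₁))
    (hb_top : Tendsto (fun x ↦ u₁ x - Complex.I * ω * u x) atTop (𝓝 0))
    (hb_bot : Tendsto (fun x ↦ u₁ x + Complex.I * ϖ * u x) atBot (𝓝 0))
    (hA_top : Tendsto (fun x ↦ ‖u x‖ ^ 2) atTop (𝓝 Atop))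
    (hA_bot : Tendsto (fun x ↦ ‖u x‖ ^ 2) atBot (𝓝 Abot))
    (hV_top : Tendsto V atTop (𝓝 0)) (hV_bot : Tendsto V atBot (𝓝 (ω ^ 2 - ϖ ^ 2)))
    (hy_top : Tendsto y atTop (𝓝 1)) (hy_bot : Tendsto y atBot (𝓝 (1 / 2)))
    (hE : 2 ≤ E) (hns : 0 ≤ ω * ϖ) :
    ∫ x, koppaBulk ω V V₁ y y₁ u u₁ x ≤
      ∫ x, (-(2 * y x * ⟪H x, u₁ x⟫_ℝ) + E * (ω * (H x * conj (u x)).im)) := by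
  have htop : Tendsto (fun x ↦ koppaCurrent ω V y u u₁ x - E * energyCurrentT ω u u₁ x)
      atTop (𝓝 (2 * ω ^ 2 * Atop - E * (ω ^ 2 * Atop))) :=
    (tendsto_koppaCurrent_atTop hy_top hV_top hb_top hA_top).sub
      ((tendsto_energyCurrentT_atTop hb_top hA_top).const_mul E)
  have hbot : Tendsto (fun x ↦ koppaCurrent ω V y u u₁ x - E * energyCurrentT ω u u₁ x)
      atBot (𝓝 (ϖ ^ 2 * Abot - E * (-(ω * ϖ * Abot)))) :=
    (tendsto_koppaCurrent_atBot hy_bot hV_bot hb_bot hA_bot).sub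
      ((tendsto_energyCurrentT_atBot hb_bot hA_bot).const_mul E)
  have hid := integral_koppaBulk_eq (E := E) hV hy hu hu₁ hode hS₁ hS₂ hP hbot htop
  have hAtop : 0 ≤ Atop := nonneg_of_tendsto_norm_sq hA_top
  have hAbot : 0 ≤ Abot := nonneg_of_tendsto_norm_sq hA_bot
  have h1 : 2 * ω ^ 2 * Atop - E * (ω ^ 2 * Atop) ≤ 0 := by
    have : 0 ≤ (E - 2) * (ω ^ 2 * Atop) := mul_nonneg (by linarith) (by positivity)
    linarith
  have h2 : 0 ≤ ϖ ^ 2 * Abot - E * (-(ω * ϖ * Abot)) := by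
    have : 0 ≤ E * (ω * ϖ) * Abot := mul_nonneg (mul_nonneg (by linarith) hns) hAbot
    have : 0 ≤ ϖ ^ 2 * Abot := by positivity
    linarith
  linarith

end Identity

/-! ### A non-negative bulk is integrable -/

section Integrability

/-- Mirror image of Mathlib's `integrableOn_Ioi_deriv_of_nonneg'`: a non-negative derivative of a
function with a limit at `−∞` is integrable on `(−∞, a]`. [folklore] -/
private theorem integrableOn_Iic_deriv_of_nonneg_aux {g g' : ℝ → ℝ} {a l : ℝ}
    (hderiv : ∀ x ∈ Iic a, HasDerivAt g (g' x) x) (g'pos : ∀ x ∈ Iic a, 0 ≤ g' x)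
    (hg : Tendsto g atBot (𝓝 l)) : IntegrableOn g' (Iic a) := by
  have hcont : ContinuousOn g (Iic a) :=
    fun x hx ↦ (hderiv x hx).continuousAt.continuousWithinAt
  have hint : ∀ z : ℝ, IntegrableOn g' (Ioc z a) := fun z ↦ by
    rcases le_or_gt z a with hza | hza
    · exact intervalIntegral.integrableOn_deriv_of_nonneg (hcont.mono Icc_subset_Iic_self)
        (fun x hx ↦ hderiv x hx.2.le) fun x hx ↦ g'pos x hx.2.le
    · rw [Ioc_eq_empty (not_lt.2 hza.le)]
      exact integrableOn_empty
  refine integrableOn_Iic_of_intervalIntegral_norm_tendsto (g a - l) a hint tendsto_id ?_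
  apply Tendsto.congr' _ ((tendsto_const_nhds (x := g a)).sub hg)
  filter_upwards [Iic_mem_atBot a] with z hz
  have hz' : id z ≤ a := hz
  calc g a - g z = ∫ x in id z..a, g' x := by
        symm
        apply intervalIntegral.integral_eq_sub_of_hasDerivAt_of_le hz'
          (hcont.mono Icc_subset_Iic_self) fun x hx ↦ hderiv x hx.2.le
        rw [intervalIntegrable_iff_integrableOn_Ioc_of_le hz']
        exact hint z
    _ = ∫ x in id z..a, ‖g' x‖ := by
        simp_rw [intervalIntegral.integral_of_le hz']
        refine setIntegral_congr_fun measurableSet_Ioc fun x hx ↦ ?_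
        rw [Real.norm_eq_abs, abs_of_nonneg (g'pos x hx.2)]

/-- If `g' = p + s` on `ℝ` with `p ≥ 0`, `s` integrable and continuous, and `g` has limits at
`±∞`, then `p` is integrable. [folklore] -/
theorem integrable_of_hasDerivAt_add_of_nonneg {g p s : ℝ → ℝ} {l₁ l₂ : ℝ}
    (hderiv : ∀ x, HasDerivAt g (p x + s x) x) (hp : ∀ x, 0 ≤ p x) (hs : Integrable s)
    (hsc : Continuous s) (hbot : Tendsto g atBot (𝓝 l₁)) (htop : Tendsto g atTop (𝓝 l₂)) :
    Integrable p := by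
  -- `G(x) = g(x) − ∫₀ˣ s` has derivative `p ≥ 0` and limits at `±∞`.
  have hGd : ∀ x, HasDerivAt (fun t ↦ g t - ∫ τ in (0 : ℝ)..t, s τ) (p x) x := fun x ↦ by
    have h := (hderiv x).sub (hsc.integral_hasStrictDerivAt 0 x).hasDerivAt
    have h' : p x + s x - s x = p x := by ring
    rw [h'] at h
    exact h
  have hItop : Tendsto (fun x ↦ ∫ t in (0 : ℝ)..x, s t) atTop (𝓝 (∫ t in Ioi 0, s t)) :=
    intervalIntegral_tendsto_integral_Ioi 0 hs.integrableOn tendsto_id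
  have hIbot : Tendsto (fun x ↦ ∫ t in (0 : ℝ)..x, s t) atBot (𝓝 (-∫ t in Iic 0, s t)) := by
    have h := intervalIntegral_tendsto_integral_Iic 0 hs.integrableOn tendsto_id
    have h' := h.neg
    refine h'.congr fun x ↦ ?_
    simp [intervalIntegral.integral_symm x 0]
  have hGtop : Tendsto (fun t ↦ g t - ∫ τ in (0 : ℝ)..t, s τ) atTop (𝓝 (l₂ - ∫ t in Ioi 0, s t)) :=
    htop.sub hItop
  have hGbot : Tendsto (fun t ↦ g t - ∫ τ in (0 : ℝ)..t, s τ) atBot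
      (𝓝 (l₁ - -∫ t in Iic 0, s t)) := hbot.sub hIbot
  have h1 : IntegrableOn p (Ioi 0) :=
    integrableOn_Ioi_deriv_of_nonneg' (fun x _ ↦ hGd x) (fun x _ ↦ hp x) hGtop
  have h2 : IntegrableOn p (Iic 0) :=
    integrableOn_Iic_deriv_of_nonneg_aux (fun x _ ↦ hGd x) (fun x _ ↦ hp x) hGbot
  have h := integrableOn_union.2 ⟨h2, h1⟩
  rwa [Iic_union_Ioi, integrableOn_univ] at h

variable {ω E : ℝ} {V V₁ y y₁ : ℝ → ℝ} {u u₁ u₂ H : ℝ → ℂ}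

/-- **A non-negative bulk is integrable**: if `u` solves `u'' + (ω² − V)u = H` on `ℝ` with `H`
continuous, the source terms are integrable, `Q = ϟ^y − E·Q^T` has limits at `±∞`, and
`P^y[u] ≥ 0` pointwise, then `P^y[u]` is integrable on `ℝ` (so `∫ P^y[u]` in
`integral_koppaBulk_le` is a genuine integral). Implicit in DRSR arXiv:1402.7034, §8.4 ("the
integrand on the left hand side is non-negative"). [folklore] -/
theorem integrable_koppaBulk_of_nonneg {qbot qtop : ℝ} (hV : ∀ x, HasDerivAt V (V₁ x) x)
    (hy : ∀ x, HasDerivAt y (y₁ x) x) (hu : ∀ x, HasDerivAt u (u₁ x) x)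
    (hu₁ : ∀ x, HasDerivAt u₁ (u₂ x) x) (hode : ∀ x, u₂ x + ((ω ^ 2 - V x : ℝ) : ℂ) * u x = H x)
    (hH : Continuous H) (hS₁ : Integrable (fun x ↦ y x * ⟪H x, u₁ x⟫_ℝ))
    (hS₂ : Integrable (fun x ↦ (H x * conj (u x)).im))
    (hbot : Tendsto (fun x ↦ koppaCurrent ω V y u u₁ x - E * energyCurrentT ω u u₁ x)
      atBot (𝓝 qbot))
    (htop : Tendsto (fun x ↦ koppaCurrent ω V y u u₁ x - E * energyCurrentT ω u u₁ x)
      atTop (𝓝 qtop))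
    (hP0 : ∀ x, 0 ≤ koppaBulk ω V V₁ y y₁ u u₁ x) :
    Integrable (koppaBulk ω V V₁ y y₁ u u₁) := by
  have hS := integrable_koppa_sub_energyT_source (E := E) (ω := ω) hS₁ hS₂
  have hyc : Continuous y := continuous_iff_continuousAt.2 fun x ↦ (hy x).continuousAt
  have huc : Continuous u := continuous_iff_continuousAt.2 fun x ↦ (hu x).continuousAt
  have hu₁c : Continuous u₁ := continuous_iff_continuousAt.2 fun x ↦ (hu₁ x).continuousAt
  have hSc : Continuous (fun x ↦ 2 * y x * ⟪H x, u₁ x⟫_ℝ - E * (ω * (H x * conj (u x)).im)) := by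
    have h1 : Continuous fun x ↦ ⟪H x, u₁ x⟫_ℝ := hH.inner hu₁c
    have h2 : Continuous fun x ↦ (H x * conj (u x)).im :=
      Complex.continuous_im.comp (hH.mul (Complex.continuous_conj.comp huc))
    exact ((continuous_const.mul hyc).mul h1).sub (continuous_const.mul (continuous_const.mul h2))
  have hderiv : ∀ x, HasDerivAt (fun t ↦ koppaCurrent ω V y u u₁ t - E * energyCurrentT ω u u₁ t)
      (koppaBulk ω V V₁ y y₁ u u₁ x +
        (2 * y x * ⟪H x, u₁ x⟫_ℝ - E * (ω * (H x * conj (u x)).im))) x := fun x ↦ by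
    have h := hasDerivAt_koppa_sub_energyT (E := E) (hV x) (hy x) (hu x) (hu₁ x) (hode x)
    simpa only [add_sub_assoc] using h
  exact integrable_of_hasDerivAt_add_of_nonneg hderiv hP0 hS hSc hbot htop

end Integrability

/-! ### The estimate of Proposition 8.4.1 -/

section Estimate

variable {ω ϖ E b Λ Atop Abot R₁ R₂ : ℝ} {V V₁ y y₁ : ℝ → ℝ} {u u₁ u₂ H : ℝ → ℂ}

/-- **The time-dominated multiplier estimate** (DRSR Prop. 8.4.1, given the Kerr-specific sign
facts as hypotheses). Let `u` solve `u'' + (ω² − V)u = H` on `ℝ` (`H` continuous, source terms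
integrable) with the boundary conditions (eq:b+) at `+∞` (`u' − iωu → 0`, `|u|² → Atop`, where
`V → 0`, `y → 1`) and (eq:b−) at `−∞` (`u' + iϖu → 0`, `|u|² → Abot`, where `V → ω² − ϖ²`, `y → ½`;
`ϖ = ω − ω₊m`). If `E ≥ 2`, the frequency is non-superradiant (`ωϖ ≥ 0`), the bulk
`P^y[u] = y'(|u'|² + (ω² − V)|u|²) − yV'|u|²` is non-negative on `ℝ` and bounds
`b(|u'|² + (ω² + Λ)|u|²)` from above on `[R₁, R₂]`, then
`b ∫_{R₁}^{R₂} (|u'|² + (ω² + Λ)|u|²) ≤ ∫_{−∞}^{∞} (−2y Re(u'H̄) + Eω Im(Hū))`.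
In loc. cit. `[R₁, R₂] = [R₋*, R₊*]` and the two sign facts are derived, for
`(ω, m, Λ) ∈ 𝓖_♯(ω_high, ε_width)` and their choice of `y`, from the bounds (someBoundS) and
(decrease) on `V = V₀ + V₁`. [cite: DafermosRodnianskiShlapentokhrothman2014, Prop. 8.4.1] -/
theorem timeDominated_estimate (hV : ∀ x, HasDerivAt V (V₁ x) x)
    (hy : ∀ x, HasDerivAt y (y₁ x) x) (hu : ∀ x, HasDerivAt u (u₁ x) x)
    (hu₁ : ∀ x, HasDerivAt u₁ (u₂ x) x) (hode : ∀ x, u₂ x + ((ω ^ 2 - V x : ℝ) : ℂ) * u x = H x)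
    (hH : Continuous H) (hS₁ : Integrable (fun x ↦ y x * ⟪H x, u₁ x⟫_ℝ))
    (hS₂ : Integrable (fun x ↦ (H x * conj (u x)).im))
    (hb_top : Tendsto (fun x ↦ u₁ x - Complex.I * ω * u x) atTop (𝓝 0))
    (hb_bot : Tendsto (fun x ↦ u₁ x + Complex.I * ϖ * u x) atBot (𝓝 0))
    (hA_top : Tendsto (fun x ↦ ‖u x‖ ^ 2) atTop (𝓝 Atop))
    (hA_bot : Tendsto (fun x ↦ ‖u x‖ ^ 2) atBot (𝓝 Abot))
    (hV_top : Tendsto V atTop (𝓝 0)) (hV_bot : Tendsto V atBot (𝓝 (ω ^ 2 - ϖ ^ 2)))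
    (hy_top : Tendsto y atTop (𝓝 1)) (hy_bot : Tendsto y atBot (𝓝 (1 / 2)))
    (hE : 2 ≤ E) (hns : 0 ≤ ω * ϖ)
    (hP0 : ∀ x, 0 ≤ koppaBulk ω V V₁ y y₁ u u₁ x) (hR : R₁ ≤ R₂)
    (hcoer : ∀ x ∈ Icc R₁ R₂,
      b * (‖u₁ x‖ ^ 2 + (ω ^ 2 + Λ) * ‖u x‖ ^ 2) ≤ koppaBulk ω V V₁ y y₁ u u₁ x) :
    b * ∫ x in R₁..R₂, (‖u₁ x‖ ^ 2 + (ω ^ 2 + Λ) * ‖u x‖ ^ 2) ≤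
      ∫ x, (-(2 * y x * ⟪H x, u₁ x⟫_ℝ) + E * (ω * (H x * conj (u x)).im)) := by
  -- limits of the current at `±∞`
  have htop : Tendsto (fun x ↦ koppaCurrent ω V y u u₁ x - E * energyCurrentT ω u u₁ x)
      atTop (𝓝 (2 * ω ^ 2 * Atop - E * (ω ^ 2 * Atop))) :=
    (tendsto_koppaCurrent_atTop hy_top hV_top hb_top hA_top).sub
      ((tendsto_energyCurrentT_atTop hb_top hA_top).const_mul E)
  have hbot : Tendsto (fun x ↦ koppaCurrent ω V y u u₁ x - E * energyCurrentT ω u u₁ x)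
      atBot (𝓝 (ϖ ^ 2 * Abot - E * (-(ω * ϖ * Abot)))) :=
    (tendsto_koppaCurrent_atBot hy_bot hV_bot hb_bot hA_bot).sub
      ((tendsto_energyCurrentT_atBot hb_bot hA_bot).const_mul E)
  -- the bulk is integrable because it is non-negative
  have hP : Integrable (koppaBulk ω V V₁ y y₁ u u₁) :=
    integrable_koppaBulk_of_nonneg (E := E) hV hy hu hu₁ hode hH hS₁ hS₂ hbot htop hP0
  have hle := integral_koppaBulk_le (E := E) hV hy hu hu₁ hode hS₁ hS₂ hP hb_top hb_bot hA_top
    hA_bot hV_top hV_bot hy_top hy_bot hE hns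
  -- restrict the bulk integral to `[R₁, R₂]`
  have huc : Continuous u := continuous_iff_continuousAt.2 fun x ↦ (hu x).continuousAt
  have hu₁c : Continuous u₁ := continuous_iff_continuousAt.2 fun x ↦ (hu₁ x).continuousAt
  have hmc : Continuous fun x ↦ b * (‖u₁ x‖ ^ 2 + (ω ^ 2 + Λ) * ‖u x‖ ^ 2) :=
    continuous_const.mul ((hu₁c.norm.pow 2).add (continuous_const.mul (huc.norm.pow 2)))
  have hstep1 : b * ∫ x in R₁..R₂, (‖u₁ x‖ ^ 2 + (ω ^ 2 + Λ) * ‖u x‖ ^ 2) ≤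
      ∫ x in R₁..R₂, koppaBulk ω V V₁ y y₁ u u₁ x := by
    rw [← intervalIntegral.integral_const_mul]
    exact intervalIntegral.integral_mono_on hR (hmc.intervalIntegrable _ _)
      (hP.intervalIntegrable) hcoer
  have hstep2 : ∫ x in R₁..R₂, koppaBulk ω V V₁ y y₁ u u₁ x ≤
      ∫ x, koppaBulk ω V V₁ y y₁ u u₁ x := by
    rw [intervalIntegral.integral_of_le hR]
    exact setIntegral_le_integral hP (Eventually.of_forall hP0)
  exact hstep1.trans (hstep2.trans hle)

end Estimate

end Kerr

end Literature.Geometry.Lorentzian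

end
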